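import Summits.QuantumAdvantage.QuantumAdvantage.Theorems.CubicForrelationNearExactIsExactTwelveLevelSixAvoidDirs
import Summits.QuantumAdvantage.QuantumAdvantage.Theorems.CubicForrelationNearExactIsExactTwelveLevelSixH34Tol

/-!
# Crux `CubicForrelation.NearExactIsExact` (stmt-QuantumAdvantage-14043) — n = 12, level ≥ 6 AT `Φ = 59/64`: (H3)/(H4) on the 9-flat by
  AVOIDANCE, tolerating a sparse off-flat residual that is not a multiple of 8

Certificate seat `b2b-cforr-cert` (gen 15).  HONEST FRAMING: a lemma (standard axioms) for the level-`≥ 6` branch of "is `59/64` attained at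
`n = 12`?"; finite-slice bookkeeping, NOT summit progress.

`tw15_H34_avoid`: cubic `f, g`, `W_g = 64u''`, `Z = {u'' even} = x_Z ⊕ V₀` (`#V₀ = 512`), `e = u'' − (−1)^f`; suppose `8 ∣ e` off
`Z ∪ (y₁ ⊕ V₀) ∪ (y₂ ⊕ V₀)` for two cosets `≠ Z`, `y₂ ∉ y₁ ⊕ V₀`, each containing at most `31` points with `8 ∤ e` (the exceptional
configurations of `tw15_off_flat_le128`).  Then (H3) `4 ∣ Σ_{3-flat ⊂ Z} e` and (H4) `8 ∣ Σ_{4-flat ⊂ Z} e`.  Mechanism of `tw6_H34_tol` (truncate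
`u − 4s` to `Z` and to the exceptional points — the difference is `≡ 0 (mod 32)` — then localise a 6- or 7-flat sum to the inner 3- or 4-flat with
`ep_loc3`), except that the three transversal directions are now CHOSEN per flat (`tw15_avoid_dirs`) so that the seven translates avoid `Z` and
the exceptional points.

References: J. Ax (1964) / R. J. McEliece (1972); MacWilliams–Sloane (1977) Ch. 13 §3.  Everything below is proved from Mathlib and the
tree; axioms are the standard three.
-/

set_option linter.dupNamespace false -- D-0017: single-problem summit ⇒ `QuantumAdvantage.QuantumAdvantage` by design

noncomputable section

namespace Summit.QuantumAdvantage.QuantumAdvantage.Theorems.CubicForrelation.NearExactIsExact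

open Finset
open Literature.Computability.QuantumComplexity
open Literature.Computability.QuantumComplexity.BuzetChailloux (bxor zeroVec bxor_bxor_cancel_left bxor_zeroVec zeroVec_bxor bxor_comm
  bxor_self)
open Literature.Computability.QuantumComplexity.DerivativeWalsh (W)

/-! ### (H3)/(H4) by avoidance -/

/-- **(H3) and (H4) on the 9-flat, avoidance version.**  As `tw6_H34_tol`, but `8 ∣ e` is only assumed off `Z` and off two further cosets
`y₁ ⊕ V₀`, `y₂ ⊕ V₀`, each of which has at most `31` points with `8 ∤ e`: every parametrised 3-flat sum of `e` inside `Z` is `≡ 0 (mod 4)` and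
every 4-flat sum is `≡ 0 (mod 8)`. [this work] -/
theorem tw15_H34_avoid (f g : (Fin (6 + 6) → Bool) → Bool) (hf : IsDegLeFun 3 f) (hg : IsDegLeFun 3 g)
    (u'' : (Fin (6 + 6) → Bool) → ℤ) (hu'' : ∀ x, W (fun y => signOf (g y)) x = (2 : ℝ) ^ 6 * (u'' x : ℝ))
    (V₀ : Finset (Fin (6 + 6) → Bool)) (xZ : Fin (6 + 6) → Bool) (h0 : zeroVec ∈ V₀)
    (hadd : ∀ a ∈ V₀, ∀ b ∈ V₀, bxor a b ∈ V₀) (hcardV : #V₀ = 512)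
    (hS : (univ.filter fun x : Fin (6 + 6) → Bool => ¬ Odd (u'' x)) = V₀.image (bxor xZ))
    (y₁ y₂ : Fin (6 + 6) → Bool) (hy₁ : y₁ ∉ (univ.filter fun x : Fin (6 + 6) → Bool => ¬ Odd (u'' x)))
    (hy₂ : y₂ ∉ (univ.filter fun x : Fin (6 + 6) → Bool => ¬ Odd (u'' x))) (hy₁₂ : y₂ ∉ V₀.image (bxor y₁))
    (hoff : ∀ y, y ∉ (univ.filter fun x : Fin (6 + 6) → Bool => ¬ Odd (u'' x)) → y ∉ V₀.image (bxor y₁) → y ∉ V₀.image (bxor y₂) →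
      (8 : ℤ) ∣ u'' y - sZ (f y))
    (hc₁ : #((V₀.image (bxor y₁)).filter fun y => ¬ (8 : ℤ) ∣ u'' y - sZ (f y)) ≤ 31)
    (hc₂ : #((V₀.image (bxor y₂)).filter fun y => ¬ (8 : ℤ) ∣ u'' y - sZ (f y)) ≤ 31) :
    (∀ x ∈ (univ.filter fun x : Fin (6 + 6) → Bool => ¬ Odd (u'' x)), ∀ a b c : Fin (6 + 6) → Bool,
      a ∈ V₀ → b ∈ V₀ → c ∈ V₀ →
      (4 : ℤ) ∣ ∑ ε : Fin 3 → Bool, (u'' (fun j => x j ^^ decide (Odd #(univ.filter fun i =>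
        ε i && (![a, b, c] : Fin 3 → Fin (6 + 6) → Bool) i j))) - sZ (f (fun j => x j ^^ decide (Odd #(univ.filter fun i =>
        ε i && (![a, b, c] : Fin 3 → Fin (6 + 6) → Bool) i j)))))) ∧
    (∀ x ∈ (univ.filter fun x : Fin (6 + 6) → Bool => ¬ Odd (u'' x)), ∀ a₀ a₁ a₂ a₃ : Fin (6 + 6) → Bool,
      a₀ ∈ V₀ → a₁ ∈ V₀ → a₂ ∈ V₀ → a₃ ∈ V₀ →
      (8 : ℤ) ∣ ∑ ε : Fin 4 → Bool, (u'' (fun j => x j ^^ decide (Odd #(univ.filter fun i =>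
        ε i && (![a₀, a₁, a₂, a₃] : Fin 4 → Fin (6 + 6) → Bool) i j))) - sZ (f (fun j => x j ^^ decide (Odd #(univ.filter fun i =>
        ε i && (![a₀, a₁, a₂, a₃] : Fin 4 → Fin (6 + 6) → Bool) i j)))))) := by
  classical
  set Z := univ.filter (fun x : Fin (6 + 6) → Bool => ¬ Odd (u'' x)) with hZdef
  set u : (Fin (6 + 6) → Bool) → ℤ := fun x => 4 * u'' x with hudef
  have hu : ∀ x, W (fun y => signOf (g y)) x = (2 : ℝ) ^ 4 * (u x : ℝ) := by
    intro x; rw [hu'' x]; simp only [u]; push_cast; ring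
  set e : (Fin (6 + 6) → Bool) → ℤ := fun x => u'' x - sZ (f x) with hedef
  show (∀ x ∈ Z, ∀ a b c : Fin (6 + 6) → Bool, a ∈ V₀ → b ∈ V₀ → c ∈ V₀ →
      (4 : ℤ) ∣ ∑ ε : Fin 3 → Bool, e (fun j => x j ^^ decide (Odd #(univ.filter fun i =>
        ε i && (![a, b, c] : Fin 3 → Fin (6 + 6) → Bool) i j)))) ∧
    (∀ x ∈ Z, ∀ a₀ a₁ a₂ a₃ : Fin (6 + 6) → Bool, a₀ ∈ V₀ → a₁ ∈ V₀ → a₂ ∈ V₀ → a₃ ∈ V₀ →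
      (8 : ℤ) ∣ ∑ ε : Fin 4 → Bool, e (fun j => x j ^^ decide (Odd #(univ.filter fun i =>
        ε i && (![a₀, a₁, a₂, a₃] : Fin 4 → Fin (6 + 6) → Bool) i j))))
  change #((V₀.image (bxor y₁)).filter fun y => ¬ (8 : ℤ) ∣ e y) ≤ 31 at hc₁
  change #((V₀.image (bxor y₂)).filter fun y => ¬ (8 : ℤ) ∣ e y) ≤ 31 at hc₂
  change ∀ y, y ∉ Z → y ∉ V₀.image (bxor y₁) → y ∉ V₀.image (bxor y₂) → (8 : ℤ) ∣ e y at hoff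
  have hFe : ∀ y, u y - 4 * sZ (f y) = 4 * e y := fun y => by simp only [u, e]; ring
  have hPV : ∀ x, x ∈ Z → ∀ a ∈ V₀, bxor x a ∈ Z := fun x hx a ha => fl1_coset_vadd hadd hS hx ha
  have hPV' : ∀ x, x ∉ Z → ∀ a ∈ V₀, bxor x a ∉ Z := fun x hx a ha => fl1_coset_out' hadd hS hx ha
  have hcos_out : ∀ p, p ∉ Z → ∀ b ∈ V₀.image (bxor p), b ∉ Z := by
    intro p hp b hb
    obtain ⟨v, hv, rfl⟩ := mem_image.1 hb
    exact hPV' p hp v hv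
  -- the truncation `F'`: `u − 4s` on `Z` and on the exceptional points, `0` elsewhere; `32 ∣ (u − 4s) − F'`
  set F' : (Fin (6 + 6) → Bool) → ℤ := fun y => if (y ∈ Z ∨ ¬ (8 : ℤ) ∣ e y) then u y - 4 * sZ (f y) else 0 with hF'
  have hdiffF : ∀ y, (32 : ℤ) ∣ (u y - 4 * sZ (f y)) - F' y := by
    intro y
    by_cases hy : (y ∈ Z ∨ ¬ (8 : ℤ) ∣ e y)
    · simp only [F', if_pos hy, sub_self]; exact dvd_zero _
    · simp only [F', if_neg hy, sub_zero]
      rw [not_or, not_not] at hy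
      obtain ⟨k, hk⟩ := hy.2
      exact ⟨k, by rw [hFe, hk]; ring⟩
  have hF'Z : ∀ y, y ∈ Z → F' y = 4 * e y := fun y hy => by simp only [F', if_pos (Or.inl hy)]; exact hFe y
  -- GOOD points: off `Z` with `8 ∣ e`; there `F' = 0`
  set G : (Fin (6 + 6) → Bool) → Prop := fun y => y ∉ Z ∧ (8 : ℤ) ∣ e y with hGdef
  have hGF : ∀ y, G y → F' y = 0 := by
    intro y hy
    simp only [F']
    rw [if_neg]
    rw [not_or, not_not]
    exact ⟨hy.1, hy.2⟩
  have hG : ∀ y, y ∉ Z → y ∉ V₀.image (bxor y₁) → y ∉ V₀.image (bxor y₂) → G y := fun y h1 h2 h3 => ⟨h1, hoff y h1 h2 h3⟩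
  have hB₁ : ∀ y ∈ V₀.image (bxor y₁), y ∉ ((V₀.image (bxor y₁)).filter fun y => ¬ (8 : ℤ) ∣ e y) → G y :=
    fun y hy hyB => ⟨hcos_out y₁ hy₁ y hy, by by_contra h8; exact hyB (mem_filter.2 ⟨hy, h8⟩)⟩
  have hB₂ : ∀ y ∈ V₀.image (bxor y₂), y ∉ ((V₀.image (bxor y₂)).filter fun y => ¬ (8 : ℤ) ∣ e y) → G y :=
    fun y hy hyB => ⟨hcos_out y₂ hy₂ y hy, by by_contra h8; exact hyB (mem_filter.2 ⟨hy, h8⟩)⟩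
  -- the localisation with avoiding directions
  have hloc : ∀ {k : ℕ}, 2 ^ k ≤ 16 → ∀ (x : Fin (6 + 6) → Bool), x ∈ Z → ∀ (a : Fin k → Fin (6 + 6) → Bool), (∀ i, a i ∈ V₀) →
      (∀ ε : Fin k → Bool, (fun j => x j ^^ decide (Odd #(univ.filter fun i => ε i && a i j))) ∈ Z) →
      ∃ t₁ t₂ t₃ : Fin (6 + 6) → Bool,
      ∑ ε : Fin (k + 3) → Bool, F' (fun j => x j ^^ decide (Odd #(univ.filter fun i =>
          ε i && (Matrix.vecCons t₁ (Matrix.vecCons t₂ (Matrix.vecCons t₃ a)) : Fin (k + 3) → Fin (6 + 6) → Bool) i j))) =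
      ∑ ε : Fin k → Bool, 4 * e (fun j => x j ^^ decide (Odd #(univ.filter fun i => ε i && a i j))) := by
    intro k hk x hx a ha hin
    obtain ⟨t₁, t₂, t₃, hgood⟩ := tw15_avoid_dirs V₀ Z xZ y₁ y₂ h0 hadd hcardV hS hy₁ hy₂ hy₁₂ G hG _ _ hB₁ hB₂ hc₁ hc₂ hk x hx a ha
    refine ⟨t₁, t₂, t₃, ?_⟩
    have key := ep_loc3 F' x t₁ t₂ t₃ a
      (fun ε => hGF _ (hgood ε).1) (fun ε => hGF _ (hgood ε).2.1) (fun ε => hGF _ (hgood ε).2.2.1)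
      (fun ε => hGF _ (hgood ε).2.2.2.1) (fun ε => hGF _ (hgood ε).2.2.2.2.1) (fun ε => hGF _ (hgood ε).2.2.2.2.2.1)
      (fun ε => hGF _ (hgood ε).2.2.2.2.2.2)
    rw [key]
    exact sum_congr rfl fun ε _ => hF'Z _ (hin ε)
  have H3 : ∀ x ∈ Z, ∀ a b c : Fin (6 + 6) → Bool, a ∈ V₀ → b ∈ V₀ → c ∈ V₀ →
      (4 : ℤ) ∣ ∑ ε : Fin 3 → Bool, e (fun j => x j ^^ decide (Odd #(univ.filter fun i =>
        ε i && (![a, b, c] : Fin 3 → Fin (6 + 6) → Bool) i j))) := by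
    intro x hx a b c ha hb hc
    have hin : ∀ ε : Fin 3 → Bool, (fun j => x j ^^ decide (Odd #(univ.filter fun i =>
        ε i && (![a, b, c] : Fin 3 → Fin (6 + 6) → Bool) i j))) ∈ Z :=
      fun ε => fr_mem_flatPt3 V₀ h0 (· ∈ Z) hPV hx ![a, b, c] (fun i => by fin_cases i <;> assumption) ε
    obtain ⟨t₁, t₂, t₃, hl⟩ := hloc (by norm_num) x hx ![a, b, c] (fun i => by fin_cases i <;> assumption) hin
    have h16 := fs_flat_sum_dvd (e := 4) g u hg hu x ![t₁, t₂, t₃, a, b, c] (by norm_num)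
    obtain ⟨zf, hzf⟩ := sl_sum_sZ_flat f hf x ![t₁, t₂, t₃, a, b, c]
    have hzf' : ∑ ε : Fin 6 → Bool, 4 * sZ (f (fun j => x j ^^ decide (Odd #(univ.filter fun i =>
          ε i && (![t₁, t₂, t₃, a, b, c] : Fin 6 → Fin (6 + 6) → Bool) i j)))) = 16 * zf := by
      rw [← mul_sum, hzf]; norm_num; ring
    have h16n : (16 : ℤ) ∣ ∑ ε : Fin 6 → Bool, u (fun j => x j ^^ decide (Odd #(univ.filter fun i =>
          ε i && (![t₁, t₂, t₃, a, b, c] : Fin 6 → Fin (6 + 6) → Bool) i j))) := by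
      have e16 : (2 : ℤ) ^ 4 = 16 := by norm_num
      rw [e16] at h16; exact h16
    have h16' : (16 : ℤ) ∣ ∑ ε : Fin 6 → Bool, (u (fun j => x j ^^ decide (Odd #(univ.filter fun i =>
          ε i && (![t₁, t₂, t₃, a, b, c] : Fin 6 → Fin (6 + 6) → Bool) i j))) -
        4 * sZ (f (fun j => x j ^^ decide (Odd #(univ.filter fun i =>
          ε i && (![t₁, t₂, t₃, a, b, c] : Fin 6 → Fin (6 + 6) → Bool) i j))))) := by
      rw [sum_sub_distrib, hzf']
      exact dvd_sub h16n (Dvd.intro _ rfl)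
    have h16'' : (16 : ℤ) ∣ ∑ ε : Fin 6 → Bool, F' (fun j => x j ^^ decide (Odd #(univ.filter fun i =>
          ε i && (![t₁, t₂, t₃, a, b, c] : Fin 6 → Fin (6 + 6) → Bool) i j))) := by
      have hd : (32 : ℤ) ∣ ∑ ε : Fin 6 → Bool, ((u (fun j => x j ^^ decide (Odd #(univ.filter fun i =>
          ε i && (![t₁, t₂, t₃, a, b, c] : Fin 6 → Fin (6 + 6) → Bool) i j))) -
        4 * sZ (f (fun j => x j ^^ decide (Odd #(univ.filter fun i =>
          ε i && (![t₁, t₂, t₃, a, b, c] : Fin 6 → Fin (6 + 6) → Bool) i j))))) -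
        F' (fun j => x j ^^ decide (Odd #(univ.filter fun i =>
          ε i && (![t₁, t₂, t₃, a, b, c] : Fin 6 → Fin (6 + 6) → Bool) i j)))) := dvd_sum fun ε _ => hdiffF _
      rw [sum_sub_distrib] at hd
      have hd' : (16 : ℤ) ∣ _ := (show (16 : ℤ) ∣ 32 by norm_num).trans hd
      have := dvd_sub h16' hd'
      simpa using this
    rw [hl, ← mul_sum] at h16''
    obtain ⟨k16, hk16⟩ := h16''
    exact ⟨k16, by linarith⟩
  have H4 : ∀ x ∈ Z, ∀ a₀ a₁ a₂ a₃ : Fin (6 + 6) → Bool, a₀ ∈ V₀ → a₁ ∈ V₀ → a₂ ∈ V₀ → a₃ ∈ V₀ →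
      (8 : ℤ) ∣ ∑ ε : Fin 4 → Bool, e (fun j => x j ^^ decide (Odd #(univ.filter fun i =>
        ε i && (![a₀, a₁, a₂, a₃] : Fin 4 → Fin (6 + 6) → Bool) i j))) := by
    intro x hx a₀ a₁ a₂ a₃ ha₀ ha₁ ha₂ ha₃
    have hin : ∀ ε : Fin 4 → Bool, (fun j => x j ^^ decide (Odd #(univ.filter fun i =>
        ε i && (![a₀, a₁, a₂, a₃] : Fin 4 → Fin (6 + 6) → Bool) i j))) ∈ Z :=
      fun ε => fr_mem_flatPt4 V₀ h0 (· ∈ Z) hPV hx ![a₀, a₁, a₂, a₃] (fun i => by fin_cases i <;> assumption) ε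
    obtain ⟨t₁, t₂, t₃, hl⟩ := hloc (by norm_num) x hx ![a₀, a₁, a₂, a₃] (fun i => by fin_cases i <;> assumption) hin
    have h32 := fs_flat_sum_dvd (e := 5) g u hg hu x ![t₁, t₂, t₃, a₀, a₁, a₂, a₃] (by norm_num)
    obtain ⟨zf, hzf⟩ := sl_sum_sZ_flat f hf x ![t₁, t₂, t₃, a₀, a₁, a₂, a₃]
    have hzf' : ∑ ε : Fin 7 → Bool, 4 * sZ (f (fun j => x j ^^ decide (Odd #(univ.filter fun i =>
          ε i && (![t₁, t₂, t₃, a₀, a₁, a₂, a₃] : Fin 7 → Fin (6 + 6) → Bool) i j)))) = 32 * zf := by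
      rw [← mul_sum, hzf]; norm_num; ring
    have h32n : (32 : ℤ) ∣ ∑ ε : Fin 7 → Bool, u (fun j => x j ^^ decide (Odd #(univ.filter fun i =>
          ε i && (![t₁, t₂, t₃, a₀, a₁, a₂, a₃] : Fin 7 → Fin (6 + 6) → Bool) i j))) := by
      have e32 : (2 : ℤ) ^ 5 = 32 := by norm_num
      rw [e32] at h32; exact h32
    have h32' : (32 : ℤ) ∣ ∑ ε : Fin 7 → Bool, (u (fun j => x j ^^ decide (Odd #(univ.filter fun i =>
          ε i && (![t₁, t₂, t₃, a₀, a₁, a₂, a₃] : Fin 7 → Fin (6 + 6) → Bool) i j))) -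
        4 * sZ (f (fun j => x j ^^ decide (Odd #(univ.filter fun i =>
          ε i && (![t₁, t₂, t₃, a₀, a₁, a₂, a₃] : Fin 7 → Fin (6 + 6) → Bool) i j))))) := by
      rw [sum_sub_distrib, hzf']
      exact dvd_sub h32n (Dvd.intro _ rfl)
    have h32'' : (32 : ℤ) ∣ ∑ ε : Fin 7 → Bool, F' (fun j => x j ^^ decide (Odd #(univ.filter fun i =>
          ε i && (![t₁, t₂, t₃, a₀, a₁, a₂, a₃] : Fin 7 → Fin (6 + 6) → Bool) i j))) := by
      have hd : (32 : ℤ) ∣ ∑ ε : Fin 7 → Bool, ((u (fun j => x j ^^ decide (Odd #(univ.filter fun i =>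
          ε i && (![t₁, t₂, t₃, a₀, a₁, a₂, a₃] : Fin 7 → Fin (6 + 6) → Bool) i j))) -
        4 * sZ (f (fun j => x j ^^ decide (Odd #(univ.filter fun i =>
          ε i && (![t₁, t₂, t₃, a₀, a₁, a₂, a₃] : Fin 7 → Fin (6 + 6) → Bool) i j))))) -
        F' (fun j => x j ^^ decide (Odd #(univ.filter fun i =>
          ε i && (![t₁, t₂, t₃, a₀, a₁, a₂, a₃] : Fin 7 → Fin (6 + 6) → Bool) i j)))) := dvd_sum fun ε _ => hdiffF _
      rw [sum_sub_distrib] at hd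
      have := dvd_sub h32' hd
      simpa using this
    rw [hl, ← mul_sum] at h32''
    obtain ⟨k32, hk32⟩ := h32''
    exact ⟨k32, by linarith⟩
  exact ⟨H3, H4⟩

end Summit.QuantumAdvantage.QuantumAdvantage.Theorems.CubicForrelation.NearExactIsExact

end
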